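import Literature.NumberTheory.IwasawaTheory.ZpExtensionLayerNormEquivariant
import Literature.NumberTheory.IwasawaTheory.ZpExtensionNormKernelLayerPair
import Literature.NumberTheory.IwasawaTheory.ZpExtensionLayerTotallyRamifiedPrime
import Literature.NumberTheory.IwasawaTheory.CyclicNormElementFixedPTorsion
import Literature.NumberTheory.NumberFields.ClassGroupNormGalois
import Literature.NumberTheory.NumberFields.ClassGroupNormSurjective
import HarnessLib

/-!
# Door UG WITHOUT the generation hypothesis over a base with `p ∤ h_K` — the layer step: `#Cl(K_{n+1})^G ≤ h(K_n)` and `N` onto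
# force `ord_p h(K_{n+1}) = ord_p h(K_n)` (every prime `p`; proved, no definition, no named fact)

Topic `NumberTheory/IwasawaTheory` (namespace = path).  THEOREMS ONLY (no definition, no named fact, no instance, no `sorry`).
Sequel of `ClassicalMuVanishesUnitNormIndexAnyPrime.lean` (att-p3 g38), whose door UG (`classNumberPExp_succ_eq_of_pow_dvd_of_sup_eq_top`:
at most `s` primes of `K_n` ramify in `K_{n+1}`, unit norm index divisible by `p^{s-1}`, AND the classes of the ramified primes generate
`Cl(K_n)` modulo `p`-th powers ⟹ `e_{n+1} = e_n`) carries the GENERATION hypothesis `hgen` — in applications a displayed datum about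
generators of a class group.  `hgen` is SUPERFLUOUS whenever the base field has `p ∤ h_K`:

**Theorem** (`padicValNat_classNumber_layer_succ_eq_of_card_fixed_le`).  `κ` a `ℤ_p`-extension of a number field `K` with `p ∤ h_K`;
`M = K_n ⊆ L = K_{n+1}` consecutive layers (any compatible algebra structure) with `N_{L/M} : Cl(L) → Cl(M)` onto and
`#Cl(L)^{Gal(L/M)} ≤ h(M)`.  Then `ord_p h(L) = ord_p h(M)`.

PROOF (Washington §13.3 read at finite level; «`Y₀ = X` when `A₀ = 0`»).  `γ` a topological generator, `g = γ|_L` (order `p^{n+1}`),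
`σ = γ^{pⁿ}|_L` generating `Gal(L/M)`.  (i) `c ↦ σc/c` has kernel the ambiguous classes and image inside `ker N`; counting,
`ker N = {σc/c}`.  (ii) THE `ν`-ELEMENT: for a `p`-primary class `c`, `ν c := ∏_{i<pⁿ} g^i c ∈ ker N`, since `N` is `Γ`-equivariant
(`classGroupNorm_layer_layer_mulEquiv_intAut_absRestrictNormalHom`): `N(ν c) = ∏_{τ ∈ Gal(M/K)} τ N(c) = i_{M/K}(N_{M/K} N c)`
(`classGroupExtend_classGroupNorm_eq_prod`), a `p`-primary class of `K` extended — trivial as `p ∤ h_K`.  (iii) Telescoping,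
`σc/c = g(νc)/νc`, so the `p`-primary part `Z` of `ker N` satisfies `Z ⊆ (g−1)Z` with `g − 1` NILPOTENT on `p`-primary classes
(`FukudaNakayama.sub_one_pow_prime_pow_apply_eq_zero_of_smul_eq_zero`); hence `Z = 1`, `p ∤ #ker N`, `h(L) = #ker N · h(M)`.

* `classGroupNorm_layer_succ_surjective` — `TotallyRamifiedFrom κ n₀`, `n₀ ≤ n` ⟹ `N : Cl(K_{n+1}) ↠ Cl(K_n)`;
* `classGroupNorm_prod_galois_pow_smul_eq_one` — the `ν`-element of a `p`-primary class is killed by the norm (`p ∤ h_K`);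
* ★ `padicValNat_classNumber_layer_succ_eq_of_card_fixed_le` — the theorem above.
The tower consequences (Chevalley's unit norm index of ONE layer ⟹ `e_{n+1} = e_n`, then `e_m = e_n` for `m ≥ n`, `μ = 0`, `λ = 0`
by Fukuda; `p = 2` forms with explicit non-norm units) are in the sequel `ClassicalMuVanishesUnitNormIndexTrivialBase.lean`.
HONEST SCOPE: classical (Washington §13.3 + genus theory); nothing specific to any summit; BSD is not advanced by this file.

## References

* L. C. Washington, *Introduction to Cyclotomic Fields*, 2nd ed., GTM 83 (1997), §13.3 Lemmas 13.14–13.18, Prop. 13.22 and its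
  proof (`A_n ≅ X/ν_n Y₀`; `Y₀ = X` when `A₀ = 0`), Thm. 10.1. [Washington1997]
* S. Lang, *Cyclotomic Fields I and II*, GTM 121 (1990), Ch. 13 §4 Lemma 4.1–4.2 (PDF pp. 203–204); Ch. 5 §4. [Lang1990]
* J. Neukirch, *Algebraic Number Theory* (1999), Ch. III §1 Prop. (1.6) (iv); Ch. I §9 Prop. (9.6). [NeukirchANT1999]
-/

noncomputable section

open NumberField IsDedekindDomain Field Finset
open scoped nonZeroDivisors

namespace Literature.NumberTheory.IwasawaTheory

open Literature.NumberTheory.EllipticCurves Literature.NumberTheory.NumberFields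
  Literature.NumberTheory.GaloisRepresentations

/-! ## §0 Two pieces of finite-group algebra -/

section Algebra

/-- `(φ − 1)^{p^k · e}` kills the `p^e`-torsion when `φ^{p^k} = 1` (iterate the tree's
`FukudaNakayama.sub_one_pow_prime_pow_apply_eq_zero_of_smul_eq_zero`: `(φ−1)^{p^k}` maps `M[p^{e+1}]` into `M[p^e]`).
[cite: Washington1997, §13.3 Lemma 13.16 (proof)] -/
private theorem sub_one_pow_mul_apply_eq_zero {M : Type*} [AddCommGroup M] (p k : ℕ) [Fact p.Prime]
    (φ : Module.End ℤ M) (hφ : φ ^ (p ^ k) = 1) :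
    ∀ (e : ℕ) (v : M), (p ^ e) • v = 0 → ((φ - 1) ^ (p ^ k * e)) v = 0 := by
  intro e
  induction e with
  | zero =>
    intro v hv
    rw [pow_zero, one_smul] at hv
    rw [hv, map_zero]
  | succ e ih =>
    intro v hv
    have hw : (p ^ e) • ((φ - 1) ^ (p ^ k)) v = 0 := by
      rw [← map_nsmul]
      refine FukudaNakayama.sub_one_pow_prime_pow_apply_eq_zero_of_smul_eq_zero p k φ hφ ?_
      rw [natCast_zsmul, smul_smul, ← pow_succ', hv]
    rw [Nat.mul_succ, pow_add, Module.End.mul_apply]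
    exact ih _ hw

/-- A `p`-primary value of an endomorphism `f` of a finite commutative group `A` has a `p`-PRIMARY preimage:
if `(f a₀)^{p^m} = 1` then `f a = f a₀` for some `a` with `a ^ p ^ s = 1`, `p^s ∥ #A` (`a = a₀^{uv}`, `#A = p^s u`,
`u v ≡ 1 (mod p^m)`). [folklore] -/
private theorem exists_primary_preimage {A : Type*} [CommGroup A] [Fintype A] (f : A →* A) {p : ℕ}
    (hp' : p.Prime) {m : ℕ} {a₀ : A} (hb : f a₀ ^ p ^ m = 1) :
    ∃ a : A, a ^ p ^ (Fintype.card A).factorization p = 1 ∧ f a = f a₀ := by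
  classical
  set h := Fintype.card A with hh
  have h0 : h ≠ 0 := Fintype.card_ne_zero
  set s := h.factorization p with hs
  set u := h / p ^ s with hu
  have hpu : Nat.Coprime u (p ^ m) := (Nat.coprime_ordCompl hp' h0).symm.pow_right m
  have hhu : p ^ s * u = h := Nat.ordProj_mul_ordCompl_eq_self h p
  rcases Nat.lt_or_ge 1 (p ^ m) with hm | hm
  · obtain ⟨v, -, hv⟩ := Nat.exists_mul_mod_eq_one_of_coprime hpu hm
    refine ⟨a₀ ^ (u * v), ?_, ?_⟩
    · rw [← pow_mul, mul_comm (u * v), ← mul_assoc, hhu, pow_mul, hh, pow_card_eq_one, one_pow]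
    · rw [map_pow]
      have huv : u * v = p ^ m * (u * v / p ^ m) + 1 := by
        have := Nat.div_add_mod (u * v) (p ^ m); rw [hv] at this; exact this.symm
      rw [huv, pow_add, pow_one, pow_mul, hb, one_pow, one_mul]
  · have hm1 : p ^ m = 1 := le_antisymm hm (Nat.one_le_iff_ne_zero.mpr (pow_ne_zero m hp'.ne_zero))
    rw [hm1, pow_one] at hb
    exact ⟨1, one_pow _, by rw [map_one, hb]⟩

/-- `∏_{τ ∈ Gal(L/F)} τ•x = ∏_{i < N} σ^i•x` for a generator `σ` of `Gal(L/F)`, `N = #Gal(L/F)`. [folklore] -/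
private theorem prod_galois_eq_prod_range_pow {F L : Type*} [Field F] [Field L] [NumberField L] [Algebra F L]
    [FiniteDimensional F L] (σ : L ≃ₐ[F] L) (hσ : Subgroup.zpowers σ = ⊤) {N : ℕ}
    (hN : Nat.card (L ≃ₐ[F] L) = N) (x : ClassGroup (𝓞 L)) :
    ∏ τ : L ≃ₐ[F] L, ClassGroup.mulEquiv (AmbiguousClass.intAut τ) x =
      ∏ i ∈ range N, ClassGroup.mulEquiv (AmbiguousClass.intAut (σ ^ i)) x := by
  classical
  have hord : orderOf σ = N := by rw [← Nat.card_zpowers, hσ, Subgroup.card_top, hN]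
  have hinj : Function.Injective (fun i : Fin N => σ ^ (i : ℕ)) := fun i j hij =>
    Fin.ext (pow_injOn_Iio_orderOf (by rw [Set.mem_Iio, hord]; exact i.2) (by rw [Set.mem_Iio, hord]; exact j.2) hij)
  have hbij : Function.Bijective (fun i : Fin N => σ ^ (i : ℕ)) := by
    rw [Fintype.bijective_iff_injective_and_card]
    exact ⟨hinj, by rw [Fintype.card_fin, ← Nat.card_eq_fintype_card, hN]⟩
  rw [← Fin.prod_univ_eq_prod_range (fun i => ClassGroup.mulEquiv (AmbiguousClass.intAut (σ ^ i)) x) N]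
  exact (Fintype.prod_bijective _ hbij (fun i => ClassGroup.mulEquiv (AmbiguousClass.intAut (σ ^ (i : ℕ))) x)
    (fun τ => ClassGroup.mulEquiv (AmbiguousClass.intAut τ) x) (fun _ => rfl)).symm

end Algebra

/-! ## §1 Two consecutive layers `K_n ⊆ K_{n+1}` -/

section Layer

variable {K : Type} [Field K] [NumberField K] {p : ℕ} [hp : Fact p.Prime] (κ : ZpExtension K p) (n : ℕ)
  [Algebra (κ.layer n) (κ.layer (n + 1))] [IsScalarTower K (κ.layer n) (κ.layer (n + 1))]

/-- **`N : Cl(K_{n+1}) → Cl(K_n)` is onto above Fukuda's index** (any compatible algebra structure `K_n → K_{n+1}`).  With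
`TotallyRamifiedFrom κ n₀` and `n₀ ≤ n`, some prime `Q` of `K_{n+1}` has inertia group over `K` containing every automorphism
fixing `K_n` (`ZpExtension.exists_isMaximal_forall_mem_inertia`), so its inertia group over `K_n` is all of `Gal(K_{n+1}/K_n)`,
`e(Q | K_n) = [K_{n+1} : K_n]` (`#I = e`), and a totally ramified prime makes the norm onto
(`classGroupNorm_surjective_of_ramificationIdx_eq_finrank`). [cite: Washington1997, §13.1 Lemma 13.3 and Thm. 10.1]
[cite: NeukirchANT1999, Ch. I §9 Prop. (9.6)] -/
theorem classGroupNorm_layer_succ_surjective {n₀ : ℕ} (hram : TotallyRamifiedFrom κ n₀) (hn : n₀ ≤ n)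
    [NumberField (κ.layer n)] [NumberField (κ.layer (n + 1))] :
    Function.Surjective (classGroupNorm (κ.layer n) (κ.layer (n + 1))) := by
  classical
  haveI : FiniteDimensional K (κ.layer n) := κ.finiteDimensional_layer_holds n
  haveI : FiniteDimensional K (κ.layer (n + 1)) := κ.finiteDimensional_layer_holds (n + 1)
  haveI : IsGalois K (κ.layer n) := κ.isGalois_layer_holds n
  haveI : IsGalois K (κ.layer (n + 1)) := κ.isGalois_layer_holds (n + 1)
  haveI : FiniteDimensional (κ.layer n) (κ.layer (n + 1)) := Module.Finite.of_restrictScalars_finite K _ _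
  haveI : IsGalois (κ.layer n) (κ.layer (n + 1)) := isGalois_layer_layer κ
  obtain ⟨Q, hQmax, hQ⟩ := κ.exists_isMaximal_forall_mem_inertia hram (n := n) (m := n + 1) hn (Nat.le_succ n)
    (by omega)
  haveI := hQmax
  -- the structure map has image `{x : (x : K̄) ∈ K_n}` (`K_n/K` is normal)
  have himg : ∀ x : κ.layer (n + 1), (x : AlgebraicClosure K) ∈ κ.layer n →
      ∃ m : κ.layer n, algebraMap (κ.layer n) (κ.layer (n + 1)) m = x := by
    intro x hx
    let f : (κ.layer n) →ₐ[K] AlgebraicClosure K :=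
      (κ.layer (n + 1)).val.comp (IsScalarTower.toAlgHom K (κ.layer n) (κ.layer (n + 1)))
    have hx' : (x : AlgebraicClosure K) ∈ f.fieldRange := by rw [AlgHom.fieldRange_of_normal]; exact hx
    obtain ⟨m, hm⟩ := AlgHom.mem_fieldRange.mp hx'
    exact ⟨m, Subtype.ext hm⟩
  -- every `K_n`-automorphism of `K_{n+1}` lies in the inertia group of `Q`
  have htop : Q.inertia ((κ.layer (n + 1)) ≃ₐ[κ.layer n] (κ.layer (n + 1))) = ⊤ := by
    refine top_le_iff.mp fun τ _ => ?_
    have hK : τ.restrictScalars K ∈ Q.inertia ((κ.layer (n + 1)) ≃ₐ[K] (κ.layer (n + 1))) := by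
      refine hQ (τ.restrictScalars K) fun x hx => ?_
      obtain ⟨m, hm⟩ := himg x hx
      rw [AlgEquiv.restrictScalars_apply, ← hm, AlgEquiv.commutes]
    intro x
    have h := hK x
    have heq : τ.restrictScalars K • x = τ • x := Subtype.ext rfl
    rwa [heq] at h
  -- hence `e(Q | K_n) = #Gal(K_{n+1}/K_n) = [K_{n+1} : K_n]`
  haveI : (Q.under (𝓞 (κ.layer n))).IsMaximal := Ideal.IsMaximal.under (𝓞 (κ.layer n)) Q
  have hcard := Ideal.card_inertia_eq_ramificationIdxIn
    (G := (κ.layer (n + 1)) ≃ₐ[κ.layer n] (κ.layer (n + 1))) (Q.under (𝓞 (κ.layer n))) Q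
  rw [htop, Subgroup.card_top, Nat.card_eq_fintype_card, ← Nat.card_eq_fintype_card, IsGalois.card_aut_eq_finrank,
    Ideal.ramificationIdxIn_eq_ramificationIdx (Q.under (𝓞 (κ.layer n))) Q
      ((κ.layer (n + 1)) ≃ₐ[κ.layer n] (κ.layer (n + 1)))] at hcard
  exact classGroupNorm_surjective_of_ramificationIdx_eq_finrank (κ.layer n) (κ.layer (n + 1)) Q hcard.symm

/-- **The `ν`-element of a `p`-primary class dies under the norm** (`p ∤ h_K`).  For a topological generator `γ` of `κ` and a
`p`-primary class `c` of `K_{n+1}`: `N_{K_{n+1}/K_n} (∏_{i<pⁿ} γ^i|_{K_{n+1}} • c) = 1`.  Indeed `N(γ^i • c) = γ^i|_{K_n} • N(c)`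
(the norm is `Γ`-equivariant), `γ|_{K_n}` generates `Gal(K_n/K)` of order `pⁿ`, so the product is
`∏_{τ ∈ Gal(K_n/K)} τ • N(c) = i(N_{K_n/K} N c)`, and the `p`-primary class `N_{K_n/K} N c` of `K` is trivial because `p ∤ h_K`.
[cite: Washington1997, §13.3 Prop. 13.22 (proof: `ν_n`, `Y₀ = X` when `A₀ = 0`)] [cite: NeukirchANT1999, Ch. III §1 Prop. (1.6) (iv)] -/
theorem classGroupNorm_prod_galois_pow_smul_eq_one [NumberField (κ.layer n)] [NumberField (κ.layer (n + 1))]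
    [Normal K (κ.layer n)] [Normal K (κ.layer (n + 1))] (hK : ¬ p ∣ classNumber K) {γ : absoluteGaloisGroup K} (hγ : κ.IsTopGenerator γ)
    {c : ClassGroup (𝓞 (κ.layer (n + 1)))} {m : ℕ} (hc : c ^ p ^ m = 1) :
    classGroupNorm (κ.layer n) (κ.layer (n + 1))
      (∏ i ∈ range (p ^ n),
        ClassGroup.mulEquiv (AmbiguousClass.intAut (absRestrictNormalHom (κ.layer (n + 1)) γ ^ i)) c) = 1 := by
  classical
  haveI : FiniteDimensional K (κ.layer n) := κ.finiteDimensional_layer_holds n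
  haveI : FiniteDimensional K (κ.layer (n + 1)) := κ.finiteDimensional_layer_holds (n + 1)
  haveI : IsGalois K (κ.layer n) := κ.isGalois_layer_holds n
  haveI : IsGalois K (κ.layer (n + 1)) := κ.isGalois_layer_holds (n + 1)
  rw [map_prod]
  have heq : ∀ i : ℕ, classGroupNorm (κ.layer n) (κ.layer (n + 1))
      (ClassGroup.mulEquiv (AmbiguousClass.intAut (absRestrictNormalHom (κ.layer (n + 1)) γ ^ i)) c) =
      ClassGroup.mulEquiv (AmbiguousClass.intAut (absRestrictNormalHom (κ.layer n) γ ^ i))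
        (classGroupNorm (κ.layer n) (κ.layer (n + 1)) c) := fun i => by
    rw [← map_pow, ← map_pow]
    exact classGroupNorm_layer_layer_mulEquiv_intAut_absRestrictNormalHom κ (γ ^ i) c
  simp_rw [heq]
  set y := classGroupNorm (κ.layer n) (κ.layer (n + 1)) c with hy
  rw [← prod_galois_eq_prod_range_pow (absRestrictNormalHom (κ.layer n) γ)
    (zpowers_absRestrictNormalHom_layer_eq_top κ hγ n)
    (by rw [IsGalois.card_aut_eq_finrank, κ.finrank_layer_holds n]) y,
    ← classGroupExtend_classGroupNorm_eq_prod K (κ.layer n) y]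
  -- `N_{K_n/K} y` is a `p`-primary class of `K`, hence trivial
  have hz : classGroupNorm K (κ.layer n) y ^ p ^ m = 1 := by
    rw [← map_pow, hy, ← map_pow, hc, map_one, map_one]
  have h1 : classGroupNorm K (κ.layer n) y = 1 := by
    have hdvd1 : orderOf (classGroupNorm K (κ.layer n) y) ∣ p ^ m := orderOf_dvd_of_pow_eq_one hz
    have hdvd2 : orderOf (classGroupNorm K (κ.layer n) y) ∣ classNumber K := orderOf_dvd_card
    have hcop : Nat.Coprime (p ^ m) (classNumber K) :=
      Nat.Coprime.pow_left m ((Nat.Prime.coprime_iff_not_dvd hp.out).mpr hK)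
    have h := Nat.dvd_gcd hdvd1 hdvd2
    rw [hcop, Nat.dvd_one] at h
    exact orderOf_eq_one_iff.mp h
  rw [h1, map_one]

/-- ★ **`ord_p h(K_{n+1}) = ord_p h(K_n)` from `N` onto and `#Cl(K_{n+1})^{Gal(K_{n+1}/K_n)} ≤ h(K_n)`, over a base with
`p ∤ h_K`** — door UG with NO generation hypothesis.  Counting gives `ker N = {σc/c}` for the generator `σ = γ^{pⁿ}` of
`Gal(K_{n+1}/K_n)`; writing `σ − 1 = (g − 1)·ν` with `g = γ|_{K_{n+1}}`, `ν = Σ_{i<pⁿ} g^i`, and using that `ν` maps `p`-primary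
classes into `ker N` (`classGroupNorm_prod_galois_pow_smul_eq_one`), the `p`-primary part `Z` of `ker N` satisfies `Z ⊆ (g−1)Z`
with `g − 1` nilpotent on `p`-primary classes — so `Z = 1`, `p ∤ #ker N`, and `h(K_{n+1}) = #ker N · h(K_n)`.
[cite: Washington1997, §13.3 Lemmas 13.15–13.18 and Prop. 13.22 (proof)] [cite: Lang1990, Ch. 13 §4 Lemma 4.1–4.2 (PDF pp. 203–204)] -/
theorem padicValNat_classNumber_layer_succ_eq_of_card_fixed_le [NumberField (κ.layer n)]
    [NumberField (κ.layer (n + 1))] (hK : ¬ p ∣ classNumber K)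
    (hN : Function.Surjective (classGroupNorm (κ.layer n) (κ.layer (n + 1))))
    (hfix : Nat.card {c : ClassGroup (𝓞 (κ.layer (n + 1))) //
        ∀ τ : (κ.layer (n + 1)) ≃ₐ[κ.layer n] (κ.layer (n + 1)), ClassGroup.mulEquiv (AmbiguousClass.intAut τ) c = c}
      ≤ classNumber (κ.layer n)) :
    padicValNat p (classNumber (κ.layer (n + 1))) = padicValNat p (classNumber (κ.layer n)) := by
  classical
  haveI : FiniteDimensional K (κ.layer n) := κ.finiteDimensional_layer_holds n
  haveI : FiniteDimensional K (κ.layer (n + 1)) := κ.finiteDimensional_layer_holds (n + 1)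
  haveI : IsGalois K (κ.layer n) := κ.isGalois_layer_holds n
  haveI : IsGalois K (κ.layer (n + 1)) := κ.isGalois_layer_holds (n + 1)
  haveI : FiniteDimensional (κ.layer n) (κ.layer (n + 1)) := Module.Finite.of_restrictScalars_finite K _ _
  haveI : Normal K (κ.layer n) := IsGalois.to_normal
  haveI : Normal K (κ.layer (n + 1)) := IsGalois.to_normal
  haveI : IsGalois (κ.layer n) (κ.layer (n + 1)) := isGalois_layer_layer κ
  have hpr : p.Prime := hp.out
  -- a topological generator `γ`, `g = γ|_{K_{n+1}}` of order `p^{n+1}`, `σ = γ^{pⁿ}` generating `Gal(K_{n+1}/K_n)`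
  obtain ⟨γ, hγ⟩ : ∃ γ : absoluteGaloisGroup K, κ.IsTopGenerator γ := κ.surjective (Multiplicative.ofAdd 1)
  obtain ⟨σ, hσx, hσ⟩ := exists_aut_layer_layer_eq_topGenerator_pow κ hγ (Nat.le_succ n)
  set g : (κ.layer (n + 1)) ≃ₐ[K] (κ.layer (n + 1)) := absRestrictNormalHom (κ.layer (n + 1)) γ with hg
  set N := classGroupNorm (κ.layer n) (κ.layer (n + 1)) with hNdef
  have hσg : ∀ c : ClassGroup (𝓞 (κ.layer (n + 1))), ClassGroup.mulEquiv (AmbiguousClass.intAut σ) c =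
      ClassGroup.mulEquiv (AmbiguousClass.intAut (g ^ p ^ n)) c := fun c => by
    rw [hg, ← map_pow]; exact mulEquiv_intAut_eq_of_forall_coe_eq_smul κ hσx c
  have hgord : g ^ p ^ (n + 1) = 1 := by
    rw [hg, ← orderOf_absRestrictNormalHom_layer κ hγ (n + 1)]; exact pow_orderOf_eq_one _
  -- the maps `f = σ − 1` and `T = g − 1`
  let f : ClassGroup (𝓞 (κ.layer (n + 1))) →* ClassGroup (𝓞 (κ.layer (n + 1))) :=
    { toFun := fun c => ClassGroup.mulEquiv (AmbiguousClass.intAut σ) c * c⁻¹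
      map_one' := by rw [map_one, inv_one, mul_one]
      map_mul' := fun a b => by rw [map_mul, mul_inv, mul_mul_mul_comm] }
  have hf : ∀ c, f c = ClassGroup.mulEquiv (AmbiguousClass.intAut σ) c * c⁻¹ := fun _ => rfl
  let T : ClassGroup (𝓞 (κ.layer (n + 1))) → ClassGroup (𝓞 (κ.layer (n + 1))) := fun c => ClassGroup.mulEquiv (AmbiguousClass.intAut g) c * c⁻¹
  -- (i) `range f = ker N`
  have h1 : f.range ≤ N.ker := by
    rintro _ ⟨c, rfl⟩
    rw [MonoidHom.mem_ker, hf, map_mul, map_inv, hNdef, classGroupNorm_galois_smul, mul_inv_cancel]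
  have hkerf : ∀ c, c ∈ f.ker ↔ ∀ τ : (κ.layer (n + 1)) ≃ₐ[κ.layer n] (κ.layer (n + 1)), ClassGroup.mulEquiv (AmbiguousClass.intAut τ) c = c := by
    intro c
    rw [MonoidHom.mem_ker, hf, mul_inv_eq_one]
    refine ⟨fun h τ => ?_, fun h => h σ⟩
    obtain ⟨k, rfl⟩ := Herbrand.exists_pow_eq_of_forall_mem_zpowers (fun τ' => by rw [hσ]; exact Subgroup.mem_top τ') τ
    induction k with
    | zero => rw [pow_zero, AmbiguousClass.mulEquiv_intAut_one, MulEquiv.refl_apply]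
    | succ k ih => rw [pow_succ, AmbiguousClass.mulEquiv_intAut_mul, MulEquiv.trans_apply, h, ih]
  have h2 : Nat.card f.ker ≤ classNumber (κ.layer n) := by
    rw [Nat.card_congr (Equiv.subtypeEquivRight hkerf)]; exact hfix
  have hcardf : Nat.card f.ker * Nat.card f.range = Nat.card (ClassGroup (𝓞 (κ.layer (n + 1)))) := by
    rw [← Subgroup.index_ker, Subgroup.card_mul_index]
  have hcardN : Nat.card N.ker * classNumber (κ.layer n) = Nat.card (ClassGroup (𝓞 (κ.layer (n + 1)))) := by
    rw [classNumber, ← Nat.card_eq_fintype_card, ← Subgroup.card_top (G := ClassGroup (𝓞 (κ.layer n))),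
      ← MonoidHom.range_eq_top.mpr hN, ← Subgroup.index_ker, Subgroup.card_mul_index]
  have hkpos : 0 < Nat.card f.ker := Nat.card_pos
  have h4 : f.range = N.ker := by
    refine Subgroup.eq_of_le_of_card_ge h1 (Nat.le_of_mul_le_mul_left ?_ hkpos)
    calc Nat.card f.ker * Nat.card N.ker ≤ classNumber (κ.layer n) * Nat.card N.ker :=
          Nat.mul_le_mul_right _ h2
      _ = Nat.card f.ker * Nat.card f.range := by rw [mul_comm, hcardN, hcardf]
  -- (ii)+(iii) telescoping: `f c = T (ν c)` with `ν c = ∏_{i<pⁿ} g^i • c`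
  have htel : ∀ c : ClassGroup (𝓞 (κ.layer (n + 1))),
      f c = T (∏ i ∈ range (p ^ n), ClassGroup.mulEquiv (AmbiguousClass.intAut (g ^ i)) c) := by
    intro c
    rw [hf, hσg]
    change _ = ClassGroup.mulEquiv (AmbiguousClass.intAut g)
        (∏ i ∈ range (p ^ n), ClassGroup.mulEquiv (AmbiguousClass.intAut (g ^ i)) c) *
      (∏ i ∈ range (p ^ n), ClassGroup.mulEquiv (AmbiguousClass.intAut (g ^ i)) c)⁻¹
    rw [map_prod]
    have hstep : ∀ i : ℕ, ClassGroup.mulEquiv (AmbiguousClass.intAut g)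
        (ClassGroup.mulEquiv (AmbiguousClass.intAut (g ^ i)) c) =
        ClassGroup.mulEquiv (AmbiguousClass.intAut (g ^ (i + 1))) c := fun i => by
      rw [pow_succ', AmbiguousClass.mulEquiv_intAut_mul, MulEquiv.trans_apply]
    simp_rw [hstep]
    have tel : (∏ i ∈ range (p ^ n), ClassGroup.mulEquiv (AmbiguousClass.intAut (g ^ (i + 1))) c) *
        (∏ i ∈ range (p ^ n), ClassGroup.mulEquiv (AmbiguousClass.intAut (g ^ i)) c)⁻¹ =
        ClassGroup.mulEquiv (AmbiguousClass.intAut (g ^ p ^ n)) c *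
          (ClassGroup.mulEquiv (AmbiguousClass.intAut (g ^ 0)) c)⁻¹ := by
      rw [← div_eq_mul_inv, ← div_eq_mul_inv, ← prod_div_distrib]
      exact prod_range_div (fun i => ClassGroup.mulEquiv (AmbiguousClass.intAut (g ^ i)) c) (p ^ n)
    rw [tel, pow_zero, AmbiguousClass.mulEquiv_intAut_one, MulEquiv.refl_apply]
  -- nilpotence of `T` on `p`-primary classes
  set a := (Fintype.card (ClassGroup (𝓞 (κ.layer (n + 1))))).factorization p with ha
  have hnil : ∀ w : ClassGroup (𝓞 (κ.layer (n + 1))), w ^ p ^ a = 1 → T^[p ^ (n + 1) * a] w = 1 := by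
    intro w hw
    set G : MulAut (ClassGroup (𝓞 (κ.layer (n + 1)))) := ClassGroup.mulEquiv (AmbiguousClass.intAut g) with hGdef
    set φ : Module.End ℤ (Additive (ClassGroup (𝓞 (κ.layer (n + 1))))) := (MonoidHom.toAdditive G.toMonoidHom).toIntLinearMap
      with hφdef
    have hφapp : ∀ y : ClassGroup (𝓞 (κ.layer (n + 1))), φ (Additive.ofMul y) = Additive.ofMul (G y) := fun y => rfl
    have hT : ∀ y : ClassGroup (𝓞 (κ.layer (n + 1))), Additive.ofMul (T y) = (φ - 1) (Additive.ofMul y) := fun y => by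
      rw [LinearMap.sub_apply, hφapp, Module.End.one_apply, ← ofMul_div, div_eq_mul_inv]
    have hTit : ∀ (r : ℕ) (y : ClassGroup (𝓞 (κ.layer (n + 1)))), Additive.ofMul (T^[r] y) = ((φ - 1) ^ r) (Additive.ofMul y) := by
      intro r
      induction r with
      | zero => intro y; rw [Function.iterate_zero, id, pow_zero, Module.End.one_apply]
      | succ r ih => intro y; rw [Function.iterate_succ_apply', hT, ih, pow_succ', Module.End.mul_apply]
    have hGpow : ∀ (i : ℕ), (ClassGroup.mulEquiv (AmbiguousClass.intAut (g ^ i)) : MulAut (ClassGroup (𝓞 (κ.layer (n + 1))))) = G ^ i := by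
      intro i
      induction i with
      | zero => rw [pow_zero, pow_zero, AmbiguousClass.mulEquiv_intAut_one, MulAut.one_def]
      | succ i ih => rw [pow_succ', pow_succ', AmbiguousClass.mulEquiv_intAut_mul, ih, MulAut.mul_def]
    have hφpow : ∀ (i : ℕ) (y : ClassGroup (𝓞 (κ.layer (n + 1)))), (φ ^ i) (Additive.ofMul y) = Additive.ofMul ((G ^ i) y) := by
      intro i
      induction i with
      | zero => intro y; rw [pow_zero, pow_zero, Module.End.one_apply, MulAut.one_apply]
      | succ i ih => intro y; rw [pow_succ', pow_succ', Module.End.mul_apply, MulAut.mul_apply, ih, hφapp]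
    have hφk : φ ^ (p ^ (n + 1)) = 1 := by
      refine LinearMap.ext fun v => ?_
      change (φ ^ (p ^ (n + 1))) (Additive.ofMul (Additive.toMul v)) = Additive.ofMul (Additive.toMul v)
      rw [hφpow, ← hGpow, hgord, AmbiguousClass.mulEquiv_intAut_one, MulEquiv.refl_apply]
    have hw' : (p ^ a) • Additive.ofMul w = 0 := by
      rw [← ofMul_pow, hw, ofMul_one]
    have key := sub_one_pow_mul_apply_eq_zero p (n + 1) φ hφk a (Additive.ofMul w) hw'
    rw [← hTit] at key
    exact Additive.ofMul.injective key
  -- the `p`-primary part of `ker N` is `T`-divisible, hence trivial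
  have hdiv : ∀ (r : ℕ) (z : ClassGroup (𝓞 (κ.layer (n + 1)))), z ∈ N.ker → z ^ p ^ a = 1 →
      ∃ w : ClassGroup (𝓞 (κ.layer (n + 1))), w ∈ N.ker ∧ w ^ p ^ a = 1 ∧ z = T^[r] w := by
    intro r
    induction r with
    | zero => exact fun z hz hza => ⟨z, hz, hza, rfl⟩
    | succ r ih =>
      intro z hz hza
      obtain ⟨w, hw, hwa, rfl⟩ := ih z hz hza
      have hw' : w ∈ f.range := by rw [h4]; exact hw
      obtain ⟨c₀, hc₀⟩ := hw'
      obtain ⟨c, hca, hc⟩ := exists_primary_preimage f hpr (m := a) (a₀ := c₀) (by rw [hc₀]; exact hwa)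
      refine ⟨∏ i ∈ range (p ^ n), ClassGroup.mulEquiv (AmbiguousClass.intAut (g ^ i)) c, ?_, ?_, ?_⟩
      · rw [MonoidHom.mem_ker, hNdef]
        have := classGroupNorm_prod_galois_pow_smul_eq_one κ n hK hγ hca
        simpa only [hg] using this
      · rw [← prod_pow]
        refine prod_eq_one fun i _ => ?_
        rw [← map_pow, hca, map_one]
      · rw [Function.iterate_succ_apply, ← htel, hc, hc₀]
  have htriv : ∀ z : ClassGroup (𝓞 (κ.layer (n + 1))), z ∈ N.ker → z ^ p ^ a = 1 → z = 1 := by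
    intro z hz hza
    obtain ⟨w, -, hwa, rfl⟩ := hdiv (p ^ (n + 1) * a) z hz hza
    exact hnil w hwa
  -- hence `p ∤ #ker N`
  have hnd : ¬ p ∣ Nat.card N.ker := by
    intro hdvd
    obtain ⟨z, hz⟩ := exists_prime_orderOf_dvd_card' (G := N.ker) p hdvd
    have hzp : (z : ClassGroup (𝓞 (κ.layer (n + 1)))) ^ p = 1 := by
      have h := pow_orderOf_eq_one z
      rw [hz] at h
      rw [← Subgroup.coe_pow, h, Subgroup.coe_one]
    have ha1 : 1 ≤ a := by
      rw [ha]
      refine hpr.factorization_pos_of_dvd Fintype.card_ne_zero ?_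
      rw [← Nat.card_eq_fintype_card, ← hcardN]
      exact hdvd.mul_right _
    have hza : (z : ClassGroup (𝓞 (κ.layer (n + 1)))) ^ p ^ a = 1 := by
      obtain ⟨b, hb⟩ := Nat.exists_eq_add_of_le ha1
      rw [hb, pow_add, pow_one, pow_mul, hzp, one_pow]
    have h1' := htriv z z.2 hza
    have : orderOf z = 1 := by
      rw [orderOf_eq_one_iff]; exact Subtype.ext h1'
    rw [this] at hz
    exact hpr.one_lt.ne' hz.symm
  -- count
  rw [show classNumber (κ.layer (n + 1)) = Nat.card N.ker * classNumber (κ.layer n) by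
      rw [hcardN, classNumber, Nat.card_eq_fintype_card],
    padicValNat.mul (Nat.card_pos (α := N.ker)).ne' (by rw [classNumber]; exact Fintype.card_ne_zero),
    padicValNat.eq_zero_of_not_dvd hnd, zero_add]

end Layer

end Literature.NumberTheory.IwasawaTheory

end
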